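import Summits.HodgeConjecture.HodgeConjecture.Theses.EisensteinMiddleThird
import Summits.HodgeConjecture.HodgeConjecture.Theorems.LimitExtensionHodgeFourfoldsLefschetzDischarged

/-!
# Route EisensteinMiddleThird — `Assembly` (assembly item stmt-HodgeConjecture-16851)

The assembly item of route `EisensteinMiddleThird`,

  TowerMiddleAlgebraic → SectorComplement → HodgeConjecture,

where `SectorComplement := EisensteinTowerHodge → HodgeConjecture`.  The crux `TowerMiddleAlgebraic`
gives, for every smooth projective fourfold `X` carrying the Eisenstein-tower uniformisation datum,
the algebraicity of its rational `(2,2)`-classes; `EisensteinTowerHodge` asks for the full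
`HodgeConjectureFor 4 X` on the same fourfolds (same datum, verbatim).  The bridge is the tree's
UNCONDITIONAL reduction of the Hodge conjecture for a smooth projective fourfold to its rational
`(2,2)`-classes, `hodgeConjectureFor_four_of_hodgeTwoTwo` (Hodge models by GAGA + Hodge
decomposition, codimension `1` by the Lefschetz theorem on `(1,1)`-classes, codimension `3` by hard
Lefschetz, the other codimensions elementary — all theorems of the tree).  No named-fact hypothesis,
no sorry.
-/

-- `Summit.HodgeConjecture.HodgeConjecture.Theorems` is the mandated namespace (single-problem
-- summit: Problem = Summit), which `linter.dupNamespace` flags on every declaration; the lakefile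
-- turns the linter off tree-wide (weak option), restated here so stand-alone elaboration is
-- warning-free too.
set_option linter.dupNamespace false

namespace Summit.HodgeConjecture.HodgeConjecture.Theorems

/-- **`TowerMiddleAlgebraic → EisensteinTowerHodge`** (route `EisensteinMiddleThird`): on a smooth
projective fourfold the Hodge conjecture follows from the algebraicity of its rational `(2,2)`-classes
(`hodgeConjectureFor_four_of_hodgeTwoTwo`, unconditional), so the middle-degree crux on the tower
fourfolds already gives the full Hodge conjecture there. [cite: Murre1977, Remark 1 (p. 230)]
[cite: VoisinHodgeI2002, Thm. 11.30] -/
theorem eisensteinMiddleThird_eisensteinTowerHodge_of_towerMiddleAlgebraic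
    (hT : Summit.HodgeConjecture.HodgeConjecture.Theses.EisensteinMiddleThird.TowerMiddleAlgebraic) :
    Summit.HodgeConjecture.HodgeConjecture.Theses.EisensteinMiddleThird.EisensteinTowerHodge :=
  fun _X hX hTower ↦ hodgeConjectureFor_four_of_hodgeTwoTwo hX (hT hX hTower)

/-- **Item stmt-HodgeConjecture-16851 (`Assembly`), route `EisensteinMiddleThird`**:
`TowerMiddleAlgebraic → SectorComplement → HodgeConjecture` — feed
`eisensteinMiddleThird_eisensteinTowerHodge_of_towerMiddleAlgebraic` to the sector complement
(equivalently, the route's deciding theorem `closes` precomposed with that bridge).  The type is the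
route decl `Summit.HodgeConjecture.HodgeConjecture.Theses.EisensteinMiddleThird.Assembly`.
[cite: Murre1977, Remark 1 (p. 230)] -/
theorem eisensteinMiddleThird_assembly_proof :
    Summit.HodgeConjecture.HodgeConjecture.Theses.EisensteinMiddleThird.Assembly :=
  fun hT hC ↦ Summit.HodgeConjecture.HodgeConjecture.Theses.EisensteinMiddleThird.closes
    (eisensteinMiddleThird_eisensteinTowerHodge_of_towerMiddleAlgebraic hT) hC

end Summit.HodgeConjecture.HodgeConjecture.Theorems
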